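import Summits.QuantumFields.YangMills.Theses.AdjointLoopFano
import HarnessLib

/-!
# `AdjointLoopFano.VacuumHolonomyFano` (item stmt-QuantumFields-23326): the sorry-free REDUCTION to its two layer-2 inputs

Route `AdjointLoopFano` (D-0145 LINE g16-B of seat ym-idea-4, rev 1; critic PASS tier B 16:21Z; BC3 birth skeleton stamped CONFORM
16:24Z).  This module lands the skeleton's composition as a theorem of the tree (hypotheses spelled out inline, no new definition):

* MEAN LOOP UPPER BOUND (`hMean`): on the window `L ≤ β^a` (`a < 2/3`), for every `δ > 0`, the vacuum mean `m₁ = ⟨FΩ, Ω⟩` of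
  `F = flowLift 0 d`, `d(u) = 4 − (Re tr u(e₀))²`, satisfies `0 ≤ m₁ ≤ C (β^{δ−2/3} + L β^{−1})` eventually;
* HOLONOMY SPREAD LOWER BOUND (`hSpread`): `Var_Ω(F) ≥ c β^{−4/3−δ}` eventually on the same window;
* ⟹ `VacuumHolonomyFano` BY NAME (`vacuumHolonomyFano_of_mean_spread`): pure exponent bookkeeping with the margin
  `δ = min((q − 2/3)/4, (q − a − 1/3)/2)`.

Also the trivial half of the first input: `F ≥ 0` pointwise, hence `0 ≤ m₁` for `Ω`-dressing (`flowLift_adjDev_nonneg`, `l2_adjDev_vacuum_nonneg`).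

HONEST FRAMING: a reduction, not a proof — both inputs are OPEN (the spread lower bound is the XL physics of the crux); K2a, R2ξ″ and every
summit statement remain OPEN; the YM mass gap is NOT proved.  No `sorry`, no new axiom, no new definition.
-- adapted from HOME bc/g16-B/VacuumHolonomyFano_birth.lean (planner-ym-idea-4-g16-0, `VacuumHolonomyFano_of`)
References: [cite: Luscher1983, §3]; [cite: ReedSimonIV1978, Thm. XIII.1].
-/

set_option autoImplicit false

noncomputable section

open MeasureTheory Filter Topology Real
open Literature.MathematicalPhysics.QuantumFieldTheory (GaugeConfig Site gaugeTransform)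
open Literature.MathematicalPhysics.QuantumLattice (fundamentalRep_apply)

namespace Summit.QuantumFields.YangMills.Theorems.AdjointLoopFano

open Summit.QuantumFields.YangMills.Theorems.FemtoTransferGap

/-! ## §1 The adjoint deviation is non-negative -/

/-- `0 ≤ d(u) = 4 − (Re tr u(e₀))²` on `SU(2)` (`|Re tr| ≤ 2`). [folklore] -/
theorem adjDev_nonneg (u : GaugeConfig 3 1 SU2) :
    0 ≤ 4 - ((su2Rep (u ((0 : Site 3 1), (0 : Fin 3)))).trace.re) ^ 2 := by
  have h1 := re_trace_le_two (u ((0 : Site 3 1), (0 : Fin 3)))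
  have h2 := neg_two_le_re_trace (u ((0 : Site 3 1), (0 : Fin 3)))
  rw [fundamentalRep_apply]
  nlinarith

/-- `0 ≤ F = flowLift 0 d` pointwise (a site average of non-negative terms). [folklore] -/
theorem flowLift_adjDev_nonneg {L : ℕ} [NeZero L] (t : ℝ) (U : GaugeConfig 3 L SU2) :
    0 ≤ flowLift t (fun u : GaugeConfig 3 1 SU2 => 4 - ((su2Rep (u ((0 : Site 3 1), (0 : Fin 3)))).trace.re) ^ 2) U := by
  rw [flowLift_eq]
  exact div_nonneg (Finset.sum_nonneg fun x _ => adjDev_nonneg _) (Nat.cast_nonneg _)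

/-- `0 ≤ m₁ = ⟨FΩ, Ω⟩ = ∫ F Ω²` for every `Ω`. [folklore] -/
theorem l2_adjDev_vacuum_nonneg {L : ℕ} [NeZero L] (t : ℝ) (Ω : GaugeConfig 3 L SU2 → ℝ) :
    0 ≤ l2 (fun U => flowLift t (fun u : GaugeConfig 3 1 SU2 =>
      4 - ((su2Rep (u ((0 : Site 3 1), (0 : Fin 3)))).trace.re) ^ 2) U * Ω U) Ω := by
  unfold l2
  exact integral_nonneg fun U => by
    have h := flowLift_adjDev_nonneg t U
    have : flowLift t (fun u : GaugeConfig 3 1 SU2 => 4 - ((su2Rep (u ((0 : Site 3 1), (0 : Fin 3)))).trace.re) ^ 2) U * Ω U * Ω U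
        = flowLift t (fun u : GaugeConfig 3 1 SU2 => 4 - ((su2Rep (u ((0 : Site 3 1), (0 : Fin 3)))).trace.re) ^ 2) U * Ω U ^ 2 := by
      ring
    rw [this]
    exact mul_nonneg h (sq_nonneg _)

/-! ## §2 The reduction -/

/-- ★ **`VacuumHolonomyFano` from MEAN LOOP UPPER + HOLONOMY SPREAD LOWER** (sorry-free composition of the BC3 birth skeleton of
item stmt-QuantumFields-23326): given `0 < a < 2/3`, `2/3 < q`, `a + 1/3 < q`, take `δ = min((q − 2/3)/4, (q − a − 1/3)/2)`; then
`M β^{−q} m₁ ≤ K (β^{e₁} + β^{e₂}) β^{−4/3−δ}` with `e₁ = 2δ + 2/3 − q < 0`, `e₂ = a + 1/3 − q + δ < 0`, each `K β^{eᵢ} ≤ c/2` eventually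
(`tendsto_rpow_neg_atTop`). [cite: Luscher1983, §3] -/
theorem vacuumHolonomyFano_of_mean_spread
    (h₁ : ∀ a δ : ℝ, 0 < a → a < 2 / 3 → 0 < δ → ∃ C β₀ : ℝ, ∃ L₀ : ℕ, ∀ β : ℝ, β₀ ≤ β → ∀ (L : ℕ) [NeZero L], L₀ ≤ L →
      (L : ℝ) ≤ β ^ a → ∀ Ω : GaugeConfig 3 L SU2 → ℝ, IsPhys Ω → l2 Ω Ω = 1 → transferApply β Ω = topValue su2Rep L β • Ω →
        0 ≤ l2 (fun U => flowLift 0 (fun u : GaugeConfig 3 1 SU2 =>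
              4 - ((su2Rep (u ((0 : Site 3 1), (0 : Fin 3)))).trace.re) ^ 2) U * Ω U) Ω ∧
          l2 (fun U => flowLift 0 (fun u : GaugeConfig 3 1 SU2 =>
              4 - ((su2Rep (u ((0 : Site 3 1), (0 : Fin 3)))).trace.re) ^ 2) U * Ω U) Ω ≤
            C * (β ^ (δ - 2 / 3) + (L : ℝ) * β ^ (-1 : ℝ)))
    (h₂ : ∀ a δ : ℝ, 0 < a → a < 2 / 3 → 0 < δ → ∃ c β₀ : ℝ, ∃ L₀ : ℕ, 0 < c ∧ ∀ β : ℝ, β₀ ≤ β → ∀ (L : ℕ) [NeZero L], L₀ ≤ L →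
      (L : ℝ) ≤ β ^ a → ∀ Ω : GaugeConfig 3 L SU2 → ℝ, IsPhys Ω → l2 Ω Ω = 1 → transferApply β Ω = topValue su2Rep L β • Ω →
        c * β ^ (-(4 : ℝ) / 3 - δ) ≤
          l2 (fun U => flowLift 0 (fun u : GaugeConfig 3 1 SU2 =>
                4 - ((su2Rep (u ((0 : Site 3 1), (0 : Fin 3)))).trace.re) ^ 2) U * Ω U)
              (fun U => flowLift 0 (fun u : GaugeConfig 3 1 SU2 =>
                4 - ((su2Rep (u ((0 : Site 3 1), (0 : Fin 3)))).trace.re) ^ 2) U * Ω U) -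
            l2 (fun U => flowLift 0 (fun u : GaugeConfig 3 1 SU2 =>
                4 - ((su2Rep (u ((0 : Site 3 1), (0 : Fin 3)))).trace.re) ^ 2) U * Ω U) Ω ^ 2) :
    Summit.QuantumFields.YangMills.Theses.AdjointLoopFano.VacuumHolonomyFano := by
  intro a q M ha ha' hq haq
  set δ : ℝ := min ((q - 2 / 3) / 4) ((q - a - 1 / 3) / 2) with hδ
  have hδpos : 0 < δ := lt_min (by linarith) (by linarith)
  have hδ1 : δ ≤ (q - 2 / 3) / 4 := min_le_left _ _
  have hδ2 : δ ≤ (q - a - 1 / 3) / 2 := min_le_right _ _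
  obtain ⟨C, β₁, L₁, hC⟩ := h₁ a δ ha ha' hδpos
  obtain ⟨c, β₂, L₂, hc, hcb⟩ := h₂ a δ ha ha' hδpos
  set e₁ : ℝ := 2 * δ + 2 / 3 - q with he₁
  set e₂ : ℝ := a + 1 / 3 - q + δ with he₂
  have he₁neg : e₁ < 0 := by rw [he₁]; linarith
  have he₂neg : e₂ < 0 := by rw [he₂]; linarith
  set K : ℝ := max M 0 * max C 1 with hK
  have hK0 : 0 ≤ K := mul_nonneg (le_max_right _ _) (le_trans zero_le_one (le_max_right _ _))
  have hc2 : (0 : ℝ) < c / 2 := by linarith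
  have hev : ∀ᶠ β : ℝ in atTop, K * β ^ e₁ ≤ c / 2 ∧ K * β ^ e₂ ≤ c / 2 := by
    have t1 : Tendsto (fun β : ℝ => K * β ^ e₁) atTop (𝓝 0) := by
      have := (tendsto_rpow_neg_atTop (y := -e₁) (by linarith)).const_mul K
      simpa only [neg_neg, mul_zero] using this
    have t2 : Tendsto (fun β : ℝ => K * β ^ e₂) atTop (𝓝 0) := by
      have := (tendsto_rpow_neg_atTop (y := -e₂) (by linarith)).const_mul K
      simpa only [neg_neg, mul_zero] using this
    exact (t1.eventually (eventually_le_nhds hc2)).and (t2.eventually (eventually_le_nhds hc2))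
  obtain ⟨β₃, hβ₃⟩ := Filter.eventually_atTop.mp hev
  refine ⟨max (max β₁ β₂) (max β₃ 1), max L₁ L₂, ?_⟩
  intro β hβ L _ hL hLa Ω hΩ hn hKΩ
  have hβ₁ : β₁ ≤ β := le_trans (le_trans (le_max_left _ _) (le_max_left _ _)) hβ
  have hβ₂ : β₂ ≤ β := le_trans (le_trans (le_max_right _ _) (le_max_left _ _)) hβ
  have hβ₃' : β₃ ≤ β := le_trans (le_trans (le_max_left _ _) (le_max_right _ _)) hβ
  have hβ1 : 1 ≤ β := le_trans (le_trans (le_max_right _ _) (le_max_right _ _)) hβ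
  have hβpos : 0 < β := lt_of_lt_of_le one_pos hβ1
  have hL₁ : L₁ ≤ L := le_trans (le_max_left _ _) hL
  have hL₂ : L₂ ≤ L := le_trans (le_max_right _ _) hL
  obtain ⟨hm0, hmC⟩ := hC β hβ₁ L hL₁ hLa Ω hΩ hn hKΩ
  have hv := hcb β hβ₂ L hL₂ hLa Ω hΩ hn hKΩ
  obtain ⟨hs1, hs2⟩ := hβ₃ β hβ₃'
  show M * β ^ (-q) * l2 (fun U => flowLift 0 (fun u : GaugeConfig 3 1 SU2 => 4 - ((su2Rep (u ((0 : Site 3 1), (0 : Fin 3)))).trace.re) ^ 2) U * Ω U) Ω ≤ l2 (fun U => flowLift 0 (fun u : GaugeConfig 3 1 SU2 => 4 - ((su2Rep (u ((0 : Site 3 1), (0 : Fin 3)))).trace.re) ^ 2) U * Ω U) (fun U => flowLift 0 (fun u : GaugeConfig 3 1 SU2 => 4 - ((su2Rep (u ((0 : Site 3 1), (0 : Fin 3)))).trace.re) ^ 2) U * Ω U) - l2 (fun U => flowLift 0 (fun u : GaugeConfig 3 1 SU2 => 4 - ((su2Rep (u ((0 : Site 3 1), (0 : Fin 3)))).trace.re)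 ^ 2) U * Ω U) Ω ^ 2 ∧
    0 < l2 (fun U => flowLift 0 (fun u : GaugeConfig 3 1 SU2 => 4 - ((su2Rep (u ((0 : Site 3 1), (0 : Fin 3)))).trace.re) ^ 2) U * Ω U) (fun U => flowLift 0 (fun u : GaugeConfig 3 1 SU2 => 4 - ((su2Rep (u ((0 : Site 3 1), (0 : Fin 3)))).trace.re) ^ 2) U * Ω U) - l2 (fun U => flowLift 0 (fun u : GaugeConfig 3 1 SU2 => 4 - ((su2Rep (u ((0 : Site 3 1), (0 : Fin 3)))).trace.re) ^ 2) U * Ω U) Ω ^ 2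
  set m : ℝ := l2 (fun U => flowLift 0 (fun u : GaugeConfig 3 1 SU2 => 4 - ((su2Rep (u ((0 : Site 3 1), (0 : Fin 3)))).trace.re) ^ 2) U * Ω U) Ω with hm
  set s : ℝ := l2 (fun U => flowLift 0 (fun u : GaugeConfig 3 1 SU2 => 4 - ((su2Rep (u ((0 : Site 3 1), (0 : Fin 3)))).trace.re) ^ 2) U * Ω U) (fun U => flowLift 0 (fun u : GaugeConfig 3 1 SU2 => 4 - ((su2Rep (u ((0 : Site 3 1), (0 : Fin 3)))).trace.re) ^ 2) U * Ω U) with hs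
  have hq0 : 0 < β ^ (-q) := Real.rpow_pos_of_pos hβpos _
  have hp43 : 0 < β ^ (-(4 : ℝ) / 3 - δ) := Real.rpow_pos_of_pos hβpos _
  have hVarpos : 0 < s - m ^ 2 := lt_of_lt_of_le (mul_pos hc hp43) hv
  refine ⟨?_, hVarpos⟩
  have hsum0 : 0 ≤ β ^ (δ - 2 / 3) + (L : ℝ) * β ^ (-1 : ℝ) :=
    add_nonneg (Real.rpow_pos_of_pos hβpos _).le (mul_nonneg (Nat.cast_nonneg _) (Real.rpow_pos_of_pos hβpos _).le)
  have step1 : M * β ^ (-q) * m ≤ K * (β ^ (-q) * (β ^ (δ - 2 / 3) + (L : ℝ) * β ^ (-1 : ℝ))) := by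
    have hqm : 0 ≤ β ^ (-q) * m := mul_nonneg hq0.le hm0
    have hmC' : m ≤ max C 1 * (β ^ (δ - 2 / 3) + (L : ℝ) * β ^ (-1 : ℝ)) :=
      le_trans hmC (mul_le_mul_of_nonneg_right (le_max_left _ _) hsum0)
    calc M * β ^ (-q) * m = M * (β ^ (-q) * m) := by ring
      _ ≤ max M 0 * (β ^ (-q) * m) := mul_le_mul_of_nonneg_right (le_max_left _ _) hqm
      _ ≤ max M 0 * (β ^ (-q) * (max C 1 * (β ^ (δ - 2 / 3) + (L : ℝ) * β ^ (-1 : ℝ)))) :=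
          mul_le_mul_of_nonneg_left (mul_le_mul_of_nonneg_left hmC' hq0.le) (le_max_right _ _)
      _ = K * (β ^ (-q) * (β ^ (δ - 2 / 3) + (L : ℝ) * β ^ (-1 : ℝ))) := by rw [hK]; ring
  have ex1 : β ^ (-q) * β ^ (δ - 2 / 3) = β ^ e₁ * β ^ (-(4 : ℝ) / 3 - δ) := by
    rw [← Real.rpow_add hβpos, ← Real.rpow_add hβpos]
    congr 1
    rw [he₁]; ring
  have ex2 : β ^ (-q) * ((L : ℝ) * β ^ (-1 : ℝ)) ≤ β ^ e₂ * β ^ (-(4 : ℝ) / 3 - δ) := by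
    have hLa' : (L : ℝ) * β ^ (-1 : ℝ) ≤ β ^ a * β ^ (-1 : ℝ) :=
      mul_le_mul_of_nonneg_right hLa (Real.rpow_pos_of_pos hβpos _).le
    calc β ^ (-q) * ((L : ℝ) * β ^ (-1 : ℝ)) ≤ β ^ (-q) * (β ^ a * β ^ (-1 : ℝ)) :=
          mul_le_mul_of_nonneg_left hLa' hq0.le
      _ = β ^ e₂ * β ^ (-(4 : ℝ) / 3 - δ) := by
          rw [← Real.rpow_add hβpos, ← Real.rpow_add hβpos, ← Real.rpow_add hβpos]
          congr 1
          rw [he₂]; ring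
  have step3 : K * (β ^ (-q) * (β ^ (δ - 2 / 3) + (L : ℝ) * β ^ (-1 : ℝ))) ≤ c * β ^ (-(4 : ℝ) / 3 - δ) := by
    have hsplit : K * (β ^ (-q) * (β ^ (δ - 2 / 3) + (L : ℝ) * β ^ (-1 : ℝ)))
        = K * (β ^ (-q) * β ^ (δ - 2 / 3)) + K * (β ^ (-q) * ((L : ℝ) * β ^ (-1 : ℝ))) := by ring
    rw [hsplit, ex1]
    have hA : K * (β ^ e₁ * β ^ (-(4 : ℝ) / 3 - δ)) ≤ c / 2 * β ^ (-(4 : ℝ) / 3 - δ) := by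
      have := mul_le_mul_of_nonneg_right hs1 hp43.le
      calc K * (β ^ e₁ * β ^ (-(4 : ℝ) / 3 - δ)) = K * β ^ e₁ * β ^ (-(4 : ℝ) / 3 - δ) := by ring
        _ ≤ c / 2 * β ^ (-(4 : ℝ) / 3 - δ) := this
    have hB : K * (β ^ (-q) * ((L : ℝ) * β ^ (-1 : ℝ))) ≤ c / 2 * β ^ (-(4 : ℝ) / 3 - δ) := by
      calc K * (β ^ (-q) * ((L : ℝ) * β ^ (-1 : ℝ))) ≤ K * (β ^ e₂ * β ^ (-(4 : ℝ) / 3 - δ)) :=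
            mul_le_mul_of_nonneg_left ex2 hK0
        _ = K * β ^ e₂ * β ^ (-(4 : ℝ) / 3 - δ) := by ring
        _ ≤ c / 2 * β ^ (-(4 : ℝ) / 3 - δ) := mul_le_mul_of_nonneg_right hs2 hp43.le
    linarith
  linarith [step1, step3, hv]


end Summit.QuantumFields.YangMills.Theorems.AdjointLoopFano

end
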